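import Literature.MathematicalPhysics.QuantumLattice.HubbardNNNHoppingFluxStiffness
import Literature.MathematicalPhysics.QuantumLattice.HubbardTorusFluxThermalBlochBound
import HarnessLib

/-!
# The thermal kinetic-energy (f-sum) bound on the superfluid stiffness of the `t–t'` Hubbard torus

Topic `Literature/MathematicalPhysics/QuantumLattice` (family `hubbard`); the positive-temperature
companion of `HubbardNNNHoppingFluxStiffness.lean` (`stiffnessTT'_mul_sq_le_kinetic_of_isGroundStateInSector`,
`T = 0`) for the two-dimensional `t–t'` Hubbard torus `hubbardTorusTT'Flux L t' U θ`
(`HubbardNNNHoppingFlux.lean`: nearest-neighbour hopping `1`, next-nearest-neighbour hopping `t'`,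
on-site `U`, threaded by the flux `θ` through a seam twist on every bond crossing `x₁ = L - 1 → 0`).
Everything here is PROVED; no named fact.

Content. Paramekanti–Trivedi–Randeria, PRB 57 (1998) 11639: at finite temperature the
twisted-boundary-condition definition of the superfluid stiffness uses the FREE ENERGY (§II), and the
kinetic-energy bound `D_s/π ≤ ⟨-k_x⟩` (eq. (3), (ke-bd)) holds with THERMAL expectation values
(§IV, "Generalization to finite temperatures": the gauge-rotated trial density matrix `U ρ₀ U†` in
the Gibbs variational principle — the entropy is unchanged, the energy term is the `T = 0`
expression with thermal averages). Hazra–Verma–Randeria, PRX 9 (2019) 031049, eq. (2):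
`D_s(T) ≤ D̃(T)` at every temperature, `D̃` the (inverse-mass weighted) kinetic energy, eq. (4);
App. C. For a band with next-nearest-neighbour hopping every diagonal bond `x → x + j_s`
(`j_0 = (1,1)`, `j_1 = (1,-1)`) advances `x₁` by one as well, so the operator paying for an
`e₁`-twist is the **`e₁`-kinetic operator**
`kinOpTT' L t' = Σ_{x,σ} (c†_{x+e₁,σ} c_{x,σ} + h.c.) + t' Σ_{s,x,σ} (c†_{x+j_s,σ} c_{x,σ} + h.c.)`
(minus the `e₁`-carrying part of the kinetic energy; `Re⟨φ, kinOpTT' φ⟩ = 2 (K_x + t' K_d)(φ)` in the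
notation of the zero-temperature file, `re_star_dotProduct_kinOpTT'_mulVec`).

Main results — for every side `L ≥ 3`, every `t', U : ℝ`, every inverse temperature `β : ℝ` and
EVERY coordinate sector, i.e. every predicate `p` on occupation sets (fixed `(N↑, N↓)`, fixed `N`,
everything, …); `Z_β(M|_p)` is `Matrix.partitionFn β` of the compression `Matrix.toBlock M p p` and
`⟨A⟩_{β,p}` the Gibbs state of the untwisted block `H^{tt'}|_p` evaluated on `A|_p`:
* `log_partitionFn_toBlock_hubbardTorusTT'Flux_ge` — **the flux costs at most the kinetic energy**:
  `log Z_β(H^{tt'}|_p) - β (1 - cos(θ/L)) Re⟨kinOpTT'⟩_{β,p} ≤ log Z_β(H^{tt'}(θ)|_p)`, i.e. for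
  `β > 0` the sector free energies `F_p = -β⁻¹ log Z_p` obey
  `F_p(θ) - F_p(0) ≤ (1 - cos(θ/L)) Re⟨kinOpTT'⟩_{β,p} = 2 (1 - cos(θ/L)) ⟨K_x + t' K_d⟩_{β,p}`;
* `thermalStiffnessTT'_mul_sq_le_kinetic` — **thermal stiffness ≤ thermal `e₁`-kinetic energy**: if
  `β ρ_s θ² ≤ log Z_p(0) - log Z_p(θ)` (`= β (F_p(θ) - F_p(0))`) for `|θ| ≤ θ₀` with
  `β, ρ_s, θ₀ > 0`, then `ρ_s L² ≤ ½ Re⟨kinOpTT'⟩_{β,p} = ⟨K_x + t' K_d⟩_{β,p}`;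
  `thermalStiffness_mul_sq_le_kinetic` is the nearest-neighbour case `t' = 0` (`hubbardTorusFlux`).
Proof (Watanabe, J. Stat. Phys. 177 (2019) 717, §2.2 for the twist bookkeeping; Bogoliubov's
convexity inequality for the free energy in place of the variational principle):
* gauge the seam flux into the uniform twist `e^{iθ/L}` per unit of `e₁`-advance
  (`partitionFn_toBlock_uniformTwistTT'_eq`, from `conj_hubbardTorusTT'Flux_eq_uniform`: the
  Lieb–Schultz–Mattis twist is diagonal in the occupation basis, so it commutes with the compression);
* Peierls–Bogoliubov at the untwisted block for `+θ` and for `-θ`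
  (`log_partitionFn_sub_le_log_partitionFn_add`): `log Z(H_{±θ}|_p) ≥ log Z(H|_p) - β Re⟨H_{±θ} - H⟩_{β,p}`;
* time reversal = entrywise conjugation reverses the flux (`hubbardTorusTT'Flux_map_conj`) and
  conjugates `Z` (`partitionFn_map_starRingEnd`): `Re Z(H_{-θ}|_p) = Re Z(H_θ|_p)`;
* the midpoint identity `H_θ + H_{-θ} - 2H = 2(1 - cos(θ/L)) · kinOpTT'` in the uniform gauge (the
  bond currents cancel between `±θ`), proved as the vanishing of a Hermitian quadratic form
  (`re_star_dotProduct_uniformTwistTT'_add_neg_mulVec`) and transported into the Gibbs state by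
  positivity (`gibbsState_nonneg_of_posSemidef` applied to `±` the defect).

Not here: the sides `L = 1, 2` (the uniform gauge needs `L ≥ 3`); the `β → ∞` limit (the
zero-temperature statement is proved directly in `HubbardNNNHoppingFluxStiffness.lean`).

## References

* A. Paramekanti, N. Trivedi, M. Randeria, *Upper bounds on the superfluid stiffness of
  disordered systems*, Phys. Rev. B 57 (1998) 11639, eq. (3), §II, §IV. [ParamekantiTrivediRanderia1998]
* T. Hazra, N. Verma, M. Randeria, Phys. Rev. X 9 (2019) 031049, eqs. (2), (4), App. C. [HazraVermaRanderia2019]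
* D. J. Scalapino, S. R. White, S. Zhang, Phys. Rev. B 47 (1993) 7995, §II (`D_s` from the flux
  dependence of the free energy). [ScalapinoWhiteZhang1993]
* H. Watanabe, J. Stat. Phys. 177 (2019) 717, §2.2.1–§2.2.3, §4.1. [Watanabe2019]
* N. Byers, C. N. Yang, Phys. Rev. Lett. 7 (1961) 46. [ByersYang1961]
-/

noncomputable section

namespace Literature.MathematicalPhysics.QuantumLattice

open Matrix Finset Literature.MathematicalPhysics.QuantumFieldTheory

open scoped ComplexConjugate ComplexOrder

variable {L : ℕ} [NeZero L]

/-! ### The `e₁`-kinetic operator and the uniformly twisted `t–t'` torus -/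

section Defs

variable (L)

/-- The **`e₁`-kinetic operator** of the `t–t'` torus:
`Σ_{x,σ} (c†_{x+e₁,σ} c_{x,σ} + c†_{x,σ} c_{x+e₁,σ}) + t' Σ_{s,x,σ} (c†_{x+j_s,σ} c_{x,σ} + c†_{x,σ} c_{x+j_s,σ})`
— every bond advancing `x₁` by one, weighted by its hopping amplitude (HVR's `D̃` operator for the
`t–t'` band, PTR's `⟨-k_x⟩`). [cite: HazraVermaRanderia2019, eq. (4)] -/
def kinOpTT' (t' : ℝ) :
    Matrix (Finset (Orb (FermionTorus 2 L))) (Finset (Orb (FermionTorus 2 L))) ℂ :=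
  (∑ x : Site 2 L, ∑ σ : Fin 2,
      (creation (orb (FermionTorus.ofTorusSite (Site.shift x 0)) σ) *
          annihilation (orb (FermionTorus.ofTorusSite x) σ) +
        creation (orb (FermionTorus.ofTorusSite x) σ) *
          annihilation (orb (FermionTorus.ofTorusSite (Site.shift x 0)) σ))) +
    (t' : ℂ) • diagPeierlsHopping L (fun _ _ => 1)

/-- The **uniformly twisted `t–t'` torus**: the Peierls phase `e^{iθ/L}` on every bond advancing
`x₁` by one (nearest-neighbour `e₁`-bonds and both diagonal families) — the gauge-equivalent form
of `hubbardTorusTT'Flux L t' U θ` (`conj_hubbardTorusTT'Flux_eq_uniform`). [cite: Watanabe2019, §2.2.3 and §4.1] -/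
def uniformTwistTT' (t' U θ : ℝ) :
    Matrix (Finset (Orb (FermionTorus 2 L))) (Finset (Orb (FermionTorus 2 L))) ℂ :=
  magneticHubbardTorus L (uniformTwistConfig L θ) 1 U +
    -(t' : ℂ) • diagPeierlsHopping L (fun _ _ => ((Circle.exp (θ / L) : Circle) : ℂ))

end Defs

/-- `kinOpTT'` is Hermitian (each summand is `X + Xᴴ`). [cite: HazraVermaRanderia2019, eq. (4)] -/
theorem isHermitian_kinOpTT' (t' : ℝ) : (kinOpTT' L t').IsHermitian := by
  refine IsHermitian.add ?_ (isHermitian_ofReal_smul (isHermitian_diagPeierlsHopping L _) _)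
  unfold Matrix.IsHermitian
  simp only [conjTranspose_sum]
  refine Finset.sum_congr rfl fun x _ => Finset.sum_congr rfl fun σ _ => ?_
  rw [conjTranspose_add, conjTranspose_creation_mul_annihilation,
    conjTranspose_creation_mul_annihilation, add_comm]

/-- The uniformly twisted `t–t'` torus is Hermitian. [cite: Watanabe2019, §2.2.3 and §4.1] -/
theorem isHermitian_uniformTwistTT' (t' U θ : ℝ) : (uniformTwistTT' L t' U θ).IsHermitian := by
  refine (magneticHubbardTorus_isHermitian _ _ _).add ?_
  rw [← Complex.ofReal_neg]
  exact isHermitian_ofReal_smul (isHermitian_diagPeierlsHopping L _) _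

/-- `Re⟨φ, kinOpTT' φ⟩ = 2 (K_x(φ) + t' K_d(φ))` with `K_x(φ) = Σ_{x,σ} Re⟨φ, c†_{x+e₁,σ} c_{x,σ} φ⟩`,
`K_d(φ) = Σ_{s,x,σ} Re⟨φ, c†_{x+j_s,σ} c_{x,σ} φ⟩` (the reversed hop has the conjugate amplitude).
[cite: HazraVermaRanderia2019, eq. (4)] -/
theorem re_star_dotProduct_kinOpTT'_mulVec (t' : ℝ) (φ : Fock (Orb (FermionTorus 2 L))) :
    (star φ ⬝ᵥ (kinOpTT' L t' *ᵥ φ)).re =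
      2 * ((∑ x : Site 2 L, ∑ σ : Fin 2,
          (star φ ⬝ᵥ ((creation (orb (FermionTorus.ofTorusSite (Site.shift x 0)) σ) *
            annihilation (orb (FermionTorus.ofTorusSite x) σ)) *ᵥ φ)).re) +
        t' * ∑ s : Fin 2, ∑ x : Site 2 L, ∑ σ : Fin 2,
          (star φ ⬝ᵥ ((creation (orb (FermionTorus.ofTorusSite (x + torusDiagJump L s)) σ) *
            annihilation (orb (FermionTorus.ofTorusSite x) σ)) *ᵥ φ)).re) := by
  have hx : (star φ ⬝ᵥ ((∑ x : Site 2 L, ∑ σ : Fin 2,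
      (creation (orb (FermionTorus.ofTorusSite (Site.shift x 0)) σ) *
          annihilation (orb (FermionTorus.ofTorusSite x) σ) +
        creation (orb (FermionTorus.ofTorusSite x) σ) *
          annihilation (orb (FermionTorus.ofTorusSite (Site.shift x 0)) σ))) *ᵥ φ)).re =
      2 * ∑ x : Site 2 L, ∑ σ : Fin 2,
          (star φ ⬝ᵥ ((creation (orb (FermionTorus.ofTorusSite (Site.shift x 0)) σ) *
            annihilation (orb (FermionTorus.ofTorusSite x) σ)) *ᵥ φ)).re := by
    simp only [Matrix.sum_mulVec, dotProduct_sum, Complex.re_sum, add_mulVec, dotProduct_add,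
      Complex.add_re, Finset.mul_sum]
    refine Finset.sum_congr rfl fun x _ => Finset.sum_congr rfl fun σ _ => ?_
    rw [star_dotProduct_creation_mul_annihilation_mulVec_swap
        (orb (FermionTorus.ofTorusSite (Site.shift x 0)) σ) (orb (FermionTorus.ofTorusSite x) σ),
      Complex.conj_re, two_mul]
  unfold kinOpTT'
  rw [add_mulVec, dotProduct_add, Complex.add_re, hx, smul_mulVec, dotProduct_smul, smul_eq_mul,
    Complex.re_ofReal_mul, re_star_dotProduct_diagPeierlsHopping_const_mulVec, Complex.one_re,
    Complex.one_im]
  ring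

/-- **The uniform twist in a fixed vector** (`L ≥ 3`):
`Re⟨φ, H_θ φ⟩ = Re⟨φ, H^{tt'} φ⟩ + 2(1 - cos(θ/L)) (K_x + t' K_d)(φ) + 2 sin(θ/L) (J_x + t' J_d)(φ)`
(`J` the imaginary parts = bond currents) — Watanabe (2019) §2.2.1 eqs. (13)–(16) for the `t–t'`
band. [cite: Watanabe2019, §2.2.3 and §4.1] -/
theorem re_star_dotProduct_uniformTwistTT'_mulVec (hL : 3 ≤ L) (t' U θ : ℝ)
    (φ : Fock (Orb (FermionTorus 2 L))) :
    (star φ ⬝ᵥ (uniformTwistTT' L t' U θ *ᵥ φ)).re =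
      (star φ ⬝ᵥ (hubbardTorusTT' L 1 t' U *ᵥ φ)).re +
      2 * (1 - Real.cos (θ / L)) *
        ((∑ x : Site 2 L, ∑ σ : Fin 2,
            (star φ ⬝ᵥ ((creation (orb (FermionTorus.ofTorusSite (Site.shift x 0)) σ) *
              annihilation (orb (FermionTorus.ofTorusSite x) σ)) *ᵥ φ)).re) +
          t' * ∑ s : Fin 2, ∑ x : Site 2 L, ∑ σ : Fin 2,
            (star φ ⬝ᵥ ((creation (orb (FermionTorus.ofTorusSite (x + torusDiagJump L s)) σ) *
              annihilation (orb (FermionTorus.ofTorusSite x) σ)) *ᵥ φ)).re) +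
      2 * Real.sin (θ / L) *
        ((∑ x : Site 2 L, ∑ σ : Fin 2,
            (star φ ⬝ᵥ ((creation (orb (FermionTorus.ofTorusSite (Site.shift x 0)) σ) *
              annihilation (orb (FermionTorus.ofTorusSite x) σ)) *ᵥ φ)).im) +
          t' * ∑ s : Fin 2, ∑ x : Site 2 L, ∑ σ : Fin 2,
            (star φ ⬝ᵥ ((creation (orb (FermionTorus.ofTorusSite (x + torusDiagJump L s)) σ) *
              annihilation (orb (FermionTorus.ofTorusSite x) σ)) *ᵥ φ)).im) := by
  have hcoe : ((Circle.exp (θ / L) : Circle) : ℂ) = Complex.exp (((θ / L : ℝ) : ℂ) * Complex.I) :=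
    Circle.coe_exp _
  unfold uniformTwistTT'
  rw [add_mulVec, dotProduct_add, Complex.add_re,
    re_star_dotProduct_magneticHubbardTorus_uniformTwistConfig_mulVec,
    magneticHubbardTorus_one_eq_hubbardTorus hL, smul_mulVec, dotProduct_smul, smul_eq_mul,
    ← Complex.ofReal_neg, Complex.re_ofReal_mul, re_star_dotProduct_diagPeierlsHopping_const_mulVec,
    hubbardTorusTT', hamiltonian_fermionTorusDiagGraph_eq_smul_diagPeierlsHopping hL, Complex.ofReal_zero,
    zero_smul, add_zero, add_mulVec, dotProduct_add, Complex.add_re, smul_mulVec, dotProduct_smul,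
    smul_eq_mul, ← Complex.ofReal_neg, Complex.re_ofReal_mul,
    re_star_dotProduct_diagPeierlsHopping_const_mulVec, hcoe, Complex.exp_ofReal_mul_I_re,
    Complex.exp_ofReal_mul_I_im, Complex.one_re, Complex.one_im, hubbardTorus]
  ring

/-- **The midpoint identity in a fixed vector**: `Re⟨φ, (H_θ + H_{-θ}) φ⟩ = 2 Re⟨φ, H^{tt'} φ⟩ +
2(1 - cos(θ/L)) Re⟨φ, kinOpTT' φ⟩` — the bond currents cancel between `±θ`, the kinetic weights pay
`1 - cos(θ/L)` per unit of `e₁`-advance. [cite: Watanabe2019, §2.2.3 and §4.1] -/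
theorem re_star_dotProduct_uniformTwistTT'_add_neg_mulVec (hL : 3 ≤ L) (t' U θ : ℝ)
    (φ : Fock (Orb (FermionTorus 2 L))) :
    (star φ ⬝ᵥ ((uniformTwistTT' L t' U θ + uniformTwistTT' L t' U (-θ)) *ᵥ φ)).re =
      2 * (star φ ⬝ᵥ (hubbardTorusTT' L 1 t' U *ᵥ φ)).re +
        2 * (1 - Real.cos (θ / L)) * (star φ ⬝ᵥ (kinOpTT' L t' *ᵥ φ)).re := by
  have hp := re_star_dotProduct_uniformTwistTT'_mulVec hL t' U θ φ
  have hm := re_star_dotProduct_uniformTwistTT'_mulVec hL t' U (-θ) φ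
  rw [neg_div, Real.cos_neg, Real.sin_neg] at hm
  rw [add_mulVec, dotProduct_add, Complex.add_re, hp, hm, re_star_dotProduct_kinOpTT'_mulVec]
  ring

/-- The **midpoint defect** `H_θ + H_{-θ} - 2 H^{tt'} - 2(1 - cos(θ/L)) kinOpTT'` and its negative
are both positive semidefinite, i.e. the defect vanishes as a quadratic form (its real part vanishes
by the midpoint identity, its imaginary part because it is Hermitian). [cite: Watanabe2019, §2.2.3 and §4.1] -/
theorem posSemidef_midpointDefect_and_neg (hL : 3 ≤ L) (t' U θ : ℝ) :
    (uniformTwistTT' L t' U θ + uniformTwistTT' L t' U (-θ) - ((2 : ℝ) : ℂ) • hubbardTorusTT' L 1 t' U -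
        ((2 * (1 - Real.cos (θ / L)) : ℝ) : ℂ) • kinOpTT' L t').PosSemidef ∧
      (-(uniformTwistTT' L t' U θ + uniformTwistTT' L t' U (-θ) - ((2 : ℝ) : ℂ) • hubbardTorusTT' L 1 t' U -
        ((2 * (1 - Real.cos (θ / L)) : ℝ) : ℂ) • kinOpTT' L t')).PosSemidef := by
  have hD : (uniformTwistTT' L t' U θ + uniformTwistTT' L t' U (-θ) -
      ((2 : ℝ) : ℂ) • hubbardTorusTT' L 1 t' U -
        ((2 * (1 - Real.cos (θ / L)) : ℝ) : ℂ) • kinOpTT' L t').IsHermitian :=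
    (((isHermitian_uniformTwistTT' t' U θ).add (isHermitian_uniformTwistTT' t' U (-θ))).sub
      (isHermitian_ofReal_smul (hubbardTorusTT'_isHermitian L 1 t' U) _)).sub
      (isHermitian_ofReal_smul (isHermitian_kinOpTT' t') _)
  have h0 : ∀ φ : Fock (Orb (FermionTorus 2 L)),
      star φ ⬝ᵥ ((uniformTwistTT' L t' U θ + uniformTwistTT' L t' U (-θ) -
        ((2 : ℝ) : ℂ) • hubbardTorusTT' L 1 t' U -
          ((2 * (1 - Real.cos (θ / L)) : ℝ) : ℂ) • kinOpTT' L t') *ᵥ φ) = 0 := by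
    intro φ
    have hre : (star φ ⬝ᵥ ((uniformTwistTT' L t' U θ + uniformTwistTT' L t' U (-θ) -
        ((2 : ℝ) : ℂ) • hubbardTorusTT' L 1 t' U -
          ((2 * (1 - Real.cos (θ / L)) : ℝ) : ℂ) • kinOpTT' L t') *ᵥ φ)).re = 0 := by
      rw [sub_mulVec, sub_mulVec, dotProduct_sub, dotProduct_sub, Complex.sub_re, Complex.sub_re,
        smul_mulVec, smul_mulVec, dotProduct_smul, dotProduct_smul, smul_eq_mul, smul_eq_mul,
        Complex.re_ofReal_mul, Complex.re_ofReal_mul,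
        re_star_dotProduct_uniformTwistTT'_add_neg_mulVec hL]
      ring
    have him : (star φ ⬝ᵥ ((uniformTwistTT' L t' U θ + uniformTwistTT' L t' U (-θ) -
        ((2 : ℝ) : ℂ) • hubbardTorusTT' L 1 t' U -
          ((2 * (1 - Real.cos (θ / L)) : ℝ) : ℂ) • kinOpTT' L t') *ᵥ φ)).im = 0 := by
      have h := hD.im_star_dotProduct_mulVec_self φ
      simpa using h
    exact Complex.ext (by simpa using hre) (by simpa using him)
  refine ⟨PosSemidef.of_dotProduct_mulVec_nonneg hD fun φ => by rw [h0 φ],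
    PosSemidef.of_dotProduct_mulVec_nonneg hD.neg fun φ => ?_⟩
  rw [neg_mulVec, dotProduct_neg, h0 φ, neg_zero]

/-! ### Sector partition functions: gauge invariance and time reversal -/

/-- **Gauge invariance of the sector partition functions** (`L ≥ 3`): the uniformly twisted `t–t'`
torus and the seam-flux torus `hubbardTorusTT'Flux L t' U θ` have the same partition function on
every coordinate sector `p` (the twist `phaseGauge (twistGauge θ)` is diagonal in the occupation
basis and commutes with the compression). [cite: Watanabe2019, §2.2.3 and §4.1] -/
theorem partitionFn_toBlock_uniformTwistTT'_eq (hL : 3 ≤ L) (t' U θ β : ℝ)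
    (p : Finset (Orb (FermionTorus 2 L)) → Prop) [Fintype {a // p a}] [DecidableEq {a // p a}] :
    partitionFn β ((uniformTwistTT' L t' U θ).toBlock p p) =
      partitionFn β ((hubbardTorusTT'Flux L t' U θ).toBlock p p) := by
  have hunit : ∀ z : Circle, star (z : ℂ) * (z : ℂ) = 1 := fun z => by
    rw [Complex.star_def, ← Complex.normSq_eq_conj_mul_self, Circle.normSq_coe, Complex.ofReal_one]
  rw [uniformTwistTT', ← conj_hubbardTorusTT'Flux_eq_uniform hL t' U θ, phaseGauge_eq,
    conjTranspose_diagonal_inst, toBlock_diagonal_mul_mul_diagonal]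
  exact partitionFn_diagonal_star_mul_mul_diagonal _ (fun a => hunit _) β _

/-- **Time reversal on a sector**: `Re Z_β(H^{tt'}(-θ)|_p) = Re Z_β(H^{tt'}(θ)|_p)` (entrywise
conjugation reverses the flux, `hubbardTorusTT'Flux_map_conj`, commutes with the compression and
conjugates `Z`). [cite: ByersYang1961] -/
theorem re_partitionFn_toBlock_hubbardTorusTT'Flux_neg (t' U θ β : ℝ)
    (p : Finset (Orb (FermionTorus 2 L)) → Prop) [Fintype {a // p a}] [DecidableEq {a // p a}] :
    (partitionFn β ((hubbardTorusTT'Flux L t' U (-θ)).toBlock p p)).re =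
      (partitionFn β ((hubbardTorusTT'Flux L t' U θ).toBlock p p)).re := by
  rw [← hubbardTorusTT'Flux_map_conj, toBlock_map, partitionFn_map_starRingEnd, Complex.conj_re]

/-! ### The thermal f-sum bound -/

/-- **The midpoint identity in the Gibbs state of a sector**: for the Gibbs state of ANY Hermitian
block Hamiltonian `B` on the sector `p`,
`Re⟨(H_θ)|_p - H^{tt'}|_p⟩ + Re⟨(H_{-θ})|_p - H^{tt'}|_p⟩ = 2(1 - cos(θ/L)) Re⟨kinOpTT'|_p⟩`
(positivity of the Gibbs state on `±` the midpoint defect). [cite: Watanabe2019, §2.2.3 and §4.1] -/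
theorem re_gibbsState_twist_add_twist_neg (hL : 3 ≤ L) (t' U θ β : ℝ)
    (p : Finset (Orb (FermionTorus 2 L)) → Prop) [Fintype {a // p a}] [DecidableEq {a // p a}]
    {B : Matrix {a // p a} {a // p a} ℂ} (hB : B.IsHermitian) :
    (gibbsState β B ((uniformTwistTT' L t' U θ).toBlock p p - (hubbardTorusTT' L 1 t' U).toBlock p p)).re +
        (gibbsState β B ((uniformTwistTT' L t' U (-θ)).toBlock p p -
          (hubbardTorusTT' L 1 t' U).toBlock p p)).re =
      2 * (1 - Real.cos (θ / L)) * (gibbsState β B ((kinOpTT' L t').toBlock p p)).re := by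
  obtain ⟨hpos, hneg⟩ := posSemidef_midpointDefect_and_neg hL t' U θ
  set D := uniformTwistTT' L t' U θ + uniformTwistTT' L t' U (-θ) -
    ((2 : ℝ) : ℂ) • hubbardTorusTT' L 1 t' U - ((2 * (1 - Real.cos (θ / L)) : ℝ) : ℂ) • kinOpTT' L t' with hDdef
  have h1 : 0 ≤ gibbsState β B (D.toBlock p p) :=
    gibbsState_nonneg_of_posSemidef β hB (hpos.submatrix Subtype.val)
  have h2 : 0 ≤ gibbsState β B ((-D).toBlock p p) :=
    gibbsState_nonneg_of_posSemidef β hB (hneg.submatrix Subtype.val)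
  have hnegblock : (-D).toBlock p p = -D.toBlock p p := rfl
  rw [hnegblock, map_neg, neg_nonneg] at h2
  have hzero : gibbsState β B (D.toBlock p p) = 0 := le_antisymm h2 h1
  have hsplit : (uniformTwistTT' L t' U θ).toBlock p p - (hubbardTorusTT' L 1 t' U).toBlock p p +
      ((uniformTwistTT' L t' U (-θ)).toBlock p p - (hubbardTorusTT' L 1 t' U).toBlock p p) =
      D.toBlock p p + ((2 * (1 - Real.cos (θ / L)) : ℝ) : ℂ) • (kinOpTT' L t').toBlock p p := by
    ext a b
    simp only [hDdef, toBlock_apply, Matrix.add_apply, Matrix.sub_apply, Matrix.smul_apply, smul_eq_mul]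
    push_cast
    ring
  rw [← Complex.add_re, ← map_add, hsplit, map_add, hzero, zero_add, map_smul, smul_eq_mul,
    Complex.re_ofReal_mul]

/-- **Thermal f-sum bound on the flux cost of the sector free energy** (`L ≥ 3`; every `t', U, β`
and every coordinate sector `p`):
`log Z_β(H^{tt'}|_p) - β (1 - cos(θ/L)) Re⟨kinOpTT'⟩_{β,p} ≤ log Z_β(H^{tt'}(θ)|_p)`, i.e. for
`β > 0`, `F_p(θ) - F_p(0) ≤ (1 - cos(θ/L)) Re⟨kinOpTT'⟩_{β,p} = 2(1 - cos(θ/L)) ⟨K_x + t' K_d⟩_{β,p}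
≤ (θ/L)² ⟨K_x + t' K_d⟩_{β,p}` whenever the latter is `≥ 0` — Paramekanti–Trivedi–Randeria (1998)
eq. (3) at finite temperature (§IV), here from Peierls–Bogoliubov at `±θ`, time reversal and the
midpoint identity. [cite: ParamekantiTrivediRanderia1998, eq. (3) and §IV] -/
theorem log_partitionFn_toBlock_hubbardTorusTT'Flux_ge (hL : 3 ≤ L) (t' U θ β : ℝ)
    (p : Finset (Orb (FermionTorus 2 L)) → Prop) [Fintype {a // p a}] [DecidableEq {a // p a}] :
    Real.log (partitionFn β ((hubbardTorusTT' L 1 t' U).toBlock p p)).re -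
        β * (1 - Real.cos (θ / L)) *
          (gibbsState β ((hubbardTorusTT' L 1 t' U).toBlock p p) ((kinOpTT' L t').toBlock p p)).re ≤
      Real.log (partitionFn β ((hubbardTorusTT'Flux L t' U θ).toBlock p p)).re := by
  rcases isEmpty_or_nonempty {a // p a} with hp | hp
  · simp [partitionFn, Matrix.trace, gibbsState_apply]
  set B := (hubbardTorusTT' L 1 t' U).toBlock p p with hBdef
  have hB : B.IsHermitian := (hubbardTorusTT'_isHermitian L 1 t' U).submatrix _
  have hWp : ((uniformTwistTT' L t' U θ).toBlock p p - B).IsHermitian :=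
    ((isHermitian_uniformTwistTT' t' U θ).submatrix _).sub hB
  have hWm : ((uniformTwistTT' L t' U (-θ)).toBlock p p - B).IsHermitian :=
    ((isHermitian_uniformTwistTT' t' U (-θ)).submatrix _).sub hB
  -- Peierls–Bogoliubov at the untwisted block, for `+θ` and `-θ`
  have hPB1 := log_partitionFn_sub_le_log_partitionFn_add hB hWp β
  have hPB2 := log_partitionFn_sub_le_log_partitionFn_add hB hWm β
  rw [add_sub_cancel, partitionFn_toBlock_uniformTwistTT'_eq hL] at hPB1 hPB2
  -- time reversal
  rw [re_partitionFn_toBlock_hubbardTorusTT'Flux_neg] at hPB2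
  -- the two first-order terms add up to the kinetic term
  have hsum := re_gibbsState_twist_add_twist_neg hL t' U θ β p hB
  rw [← hBdef] at hsum
  have hkey : β * (gibbsState β B ((uniformTwistTT' L t' U θ).toBlock p p - B)).re +
      β * (gibbsState β B ((uniformTwistTT' L t' U (-θ)).toBlock p p - B)).re =
        β * (2 * (1 - Real.cos (θ / L)) * (gibbsState β B ((kinOpTT' L t').toBlock p p)).re) := by
    rw [← mul_add, hsum]
  linarith

/-- **Thermal superfluid stiffness ≤ thermal `e₁`-kinetic energy** (`L ≥ 3`; every `t', U`, every
`β > 0`, every coordinate sector `p`): if the sector free energy is stiff in the flux,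
`β ρ_s θ² ≤ log Z_p(0) - log Z_p(θ)` (`= β (F_p(θ) - F_p(0))`) for `|θ| ≤ θ₀` with `ρ_s, θ₀ > 0`,
then `ρ_s L² ≤ ½ Re⟨kinOpTT'⟩_{β,p} = ⟨K_x + t' K_d⟩_{β,p}` — the finite-temperature kinetic-energy
bound `D_s/π ≤ ⟨-k_x⟩` of Paramekanti–Trivedi–Randeria (eq. (3), §IV) / `D_s(T) ≤ D̃(T)` of
Hazra–Verma–Randeria (eq. (2)) for the `t–t'` torus in the canonical sector ensembles. Proof: the
`θ₀` instance of the f-sum bound gives `ρ_s θ₀² ≤ (1 - cos(θ₀/L)) Re⟨kinOpTT'⟩`, which forces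
`Re⟨kinOpTT'⟩ ≥ 0` and then is `≤ (θ₀/L)²/2 · Re⟨kinOpTT'⟩`. [cite: ParamekantiTrivediRanderia1998, eq. (3) and §IV] -/
theorem thermalStiffnessTT'_mul_sq_le_kinetic (hL : 3 ≤ L) (t' U : ℝ) {β ρs θ₀ : ℝ} (hβ : 0 < β)
    (hρs : 0 < ρs) (hθ₀ : 0 < θ₀)
    (p : Finset (Orb (FermionTorus 2 L)) → Prop) [Fintype {a // p a}] [DecidableEq {a // p a}]
    (hstiff : ∀ θ : ℝ, |θ| ≤ θ₀ → β * ρs * θ ^ 2 ≤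
        Real.log (partitionFn β ((hubbardTorusTT'Flux L t' U 0).toBlock p p)).re -
          Real.log (partitionFn β ((hubbardTorusTT'Flux L t' U θ).toBlock p p)).re) :
    ρs * (L : ℝ) ^ 2 ≤
      (gibbsState β ((hubbardTorusTT' L 1 t' U).toBlock p p) ((kinOpTT' L t').toBlock p p)).re / 2 := by
  set K := (gibbsState β ((hubbardTorusTT' L 1 t' U).toBlock p p) ((kinOpTT' L t').toBlock p p)).re
    with hK
  have hL0 : (0 : ℝ) < L := Nat.cast_pos.2 (NeZero.pos L)
  have hA := log_partitionFn_toBlock_hubbardTorusTT'Flux_ge hL t' U θ₀ β p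
  rw [← hK] at hA
  have hE := hstiff θ₀ (by rw [abs_of_pos hθ₀])
  rw [hubbardTorusTT'Flux_zero] at hE
  -- `β ρ_s θ₀² ≤ β (1 - cos(θ₀/L)) K`, hence `ρ_s θ₀² ≤ (1 - cos(θ₀/L)) K`
  have h2 : β * (ρs * θ₀ ^ 2) ≤ β * ((1 - Real.cos (θ₀ / L)) * K) := by nlinarith
  have h2' : ρs * θ₀ ^ 2 ≤ (1 - Real.cos (θ₀ / L)) * K := le_of_mul_le_mul_left h2 hβ
  have hc : 0 ≤ 1 - Real.cos (θ₀ / L) := sub_nonneg.2 (Real.cos_le_one _)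
  have hθ2 : 0 < θ₀ ^ 2 := by positivity
  have hKpos : 0 ≤ K := by
    by_contra hneg
    have hneg' : K < 0 := lt_of_not_ge hneg
    have : (1 - Real.cos (θ₀ / L)) * K ≤ 0 := mul_nonpos_of_nonneg_of_nonpos hc hneg'.le
    nlinarith
  have hstep : 2 * (1 - Real.cos (θ₀ / L)) * K ≤ (θ₀ / L) ^ 2 * K :=
    two_mul_one_sub_cos_mul_le _ _ hKpos
  have h3 : 2 * (ρs * θ₀ ^ 2) ≤ θ₀ ^ 2 / (L : ℝ) ^ 2 * K := by
    have := hstep; rw [div_pow] at this; nlinarith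
  rw [div_mul_eq_mul_div, le_div_iff₀ (by positivity)] at h3
  rw [le_div_iff₀ (by norm_num : (0 : ℝ) < 2)]
  nlinarith

/-- **The nearest-neighbour case `t' = 0`**: for the flux-threaded Hubbard torus
`hubbardTorusFlux L U θ` of the tree, a thermal flux stiffness `β ρ_s θ² ≤ log Z_p(0) - log Z_p(θ)`
(`|θ| ≤ θ₀`) on a coordinate sector forces `ρ_s L² ≤ ½ Re⟨Σ_{x,σ} (c†_{x+e₁,σ} c_{x,σ} + h.c.)⟩_{β,p}
= ⟨K_x⟩_{β,p}` — the positive-temperature form of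
`stiffness_mul_sq_le_sum_re_hop_of_isGroundStateInSector`. [cite: ParamekantiTrivediRanderia1998, eq. (3) and §IV] -/
theorem thermalStiffness_mul_sq_le_kinetic (hL : 3 ≤ L) (U : ℝ) {β ρs θ₀ : ℝ} (hβ : 0 < β)
    (hρs : 0 < ρs) (hθ₀ : 0 < θ₀)
    (p : Finset (Orb (FermionTorus 2 L)) → Prop) [Fintype {a // p a}] [DecidableEq {a // p a}]
    (hstiff : ∀ θ : ℝ, |θ| ≤ θ₀ → β * ρs * θ ^ 2 ≤
        Real.log (partitionFn β ((hubbardTorusFlux L U 0).toBlock p p)).re -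
          Real.log (partitionFn β ((hubbardTorusFlux L U θ).toBlock p p)).re) :
    ρs * (L : ℝ) ^ 2 ≤
      (gibbsState β ((hubbardTorus 2 L 1 U).toBlock p p) ((kinOpTT' L 0).toBlock p p)).re / 2 := by
  have h := thermalStiffnessTT'_mul_sq_le_kinetic hL 0 U hβ hρs hθ₀ p
    (by simpa only [hubbardTorusTT'Flux_tPrime_zero] using hstiff)
  simpa only [hubbardTorusTT'_zero] using h

end Literature.MathematicalPhysics.QuantumLattice

end
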